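import Literature.MathematicalPhysics.QuantumFieldTheory.Balaban1983to89.B13GreenSymLettersOfReg335
import Literature.MathematicalPhysics.QuantumFieldTheory.Balaban1983to89.B13GreenStationLocated
import Literature.MathematicalPhysics.QuantumFieldTheory.Balaban1983to89.B13XinvSymLettersOfReg335Located

/-!
# `Balaban1983to89.B13GreenSymLettersOfReg335Located` — T. Bałaban, *Propagators for lattice gauge theories in a background field*, Commun. Math. Phys. **99** (1985)
# 389–434 [Balaban1985BackgroundPropagators], (3.19)–(3.27) pp. 393–395 (`Q′(U)`, `R(U)`, `Δ_a(U)`, `G(U)`), (3.35) p. 396, Thms 3.1–3.4 pp. 397–400, (3.84)–(3.86) p. 407,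
# Thm 3.10 (3.107)–(3.108) p. 416, Thm 3.11 p. 416; *Renormalization group approach to lattice gauge field theories. II*, Commun. Math. Phys. **116** (1988) 1–22
# [Balaban1988RG2Cluster], (2.5)–(2.7) pp. 12–13, p. 15: ★★★★ dag-n10-w2's END-TO-END v4 G-CHAIN ON THE (3.35) CLASS (`B13GreenSymLettersOfReg335` §1) LOCATED — the `Q′`
# kernel numerals as numbers (`D_Q′ = (d+1)(L^k − 1)`, `C_{Q′*} = C_{Q′} = 1`) and EVERY NODE-00 numeral of the chain a number at `(M_N(ℂ), matrix units, fineReadingY ∕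
# blkReadingY ∕ bondReadingY)`: the chain's ≈ 45 dictionary binders collapse to the reading's period vector `hNf`.

THE DISPLAY OF THE CHAIN.  dag-n10-w2 g3's `exists_rawEntryLetters_toMatrix_GAY_recordV4_prodCfg_of_reg335_of_posDefTr` writes print's Sect. B chain
`G′ → (Q′G′²Q′*)⁻¹ → R → Δ_a → G` at NODE 00's v4 letters of record on the (3.35) class with TWO analytic inputs (the X⁻¹-junction's output `hXi`; row 17's one clause
`PosDefTr w (Δ_a(U₀))`) and, besides, the NODE-00 dictionary numerals and readings of all four stations: 79's `D, Cavg, ℓ′, s, κ, m`; the R-station's `D_Q, CQsr, CQc, ℓB, r`;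
76's `c₁ c₂ N_b D_a c_Q c_{Q*} c_a, ℓF, s_F`; the G-station's `CgR CdC r′, m_F`.  EVERY ONE of them is today a number or a tree theorem BY NAME: dag-n10-w6's
`B13SiteReadingNumerals` (`fineReadingY`: `D = 2(d+1)(L^k − 1)`, `Cavg = 1` (n06's `sum_abs_avgCoeffY_le_one`), `s = (d+1)L^k`, `κ = 1∕((d+1)L^k)`, `m = N²`), this seat's
`B13BlockBondReadingNumerals` (`blkReadingY ∕ bondReadingY`: `r = (d+1)(L^k − 1)`, `r′ = 1`, `m_F = (d+1)N²`, `hℓp`), `B13BondAveragingReadingNumerals` (`D_a = (d+2)(L^k − 1)`, `hℓq`),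
dag-n10-w6's `B13CurlIncidenceNumerals` (`c₁ c₂ N_b`), `B13DeltaAPencilLettersLocated` §1 (`c_Q = 1`, `c_{Q*} = 2`, `c_a = |b₁|c_f²(L^k)^{d+1}`, `s_F = 2(d+2)(L^k − 1)`),
`B13GreenStationLocated` §1 (`CgR = CdC = 2|c_f|`), and §1 HERE — the `Q′` kernel numerals: `hDQ ∕ hDQs` (a site lies within `(d+1)(L^k − 1)` steps of its block's corner:
this seat's `tdist_chart_blkCornerY_le_of_blkOf_eq` + n06's `qpK_ne_zero_imp ∕ qpsK_ne_zero_imp`) and `CQsr = CQc = 1` (`Q′*(z,s) = [z ∈ Δ(s)]`, `Q′(s,z) = [z ∈ Δ(s)]∕W(s)`,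
`W(s) ≥ 1`: one block per site).  §2 is the chain LOCATED: what stays displayed is the (3.35) data (`hG hC0 hC1 hreg`), `hNf`, `η`, `0 < Rc`, the target rate
`0 ≤ ρ′ < δ₀∕((d+1)L^k)`, the radius `0 < R′ ≤ R₁⋆` (79's located thin radius with the numbers written in — dag-n10-w6's `…_fineReading_record` expression), the
X⁻¹-junction's output `hXi` at `(blkReadingY, R′, ρ_X)` with `0 ≤ ρ_X ≤ ρ′` and the R-station's rate loss `0 < μ`, `2μ < ρ_X`, and row 17's clause `(w, Θ, hpd)`.

[folklore] finite-lattice bookkeeping (§1) + ONE positional application of a cited tree theorem (§2); kernel-checked; THEOREMS ONLY (no `def`, no `structure`, no instance, no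
notation; `open scoped Matrix.Norms.L2Operator` = the record's norm); NOTHING of NODE 00's ∕ pv27's ∕ dag-n10-w2's ∕ dag-n10-w5's ∕ dag-n10-w6's ∕ the lane's files is modified;
nothing here is a claim about the Yang–Mills mass gap; no node is discharged; count-neutral.

WHY THIS FILE (cell `pub-ymgap`, HUMAN RULING D-0062 ∕ D-0149, Track A node N10 = [B13]; WIDTH SEAT `pub-ymgap-dag-n10-w4` g5, CLAIM-4 (R455 (A)); lane owner dag-n10-c's
RESIDUAL CENSUS v18 item 1 «N10 half DONE end to end (w2 g3 INTENT-5)» — this is that sentence with the NODE-00 side numeric).  WHICH reading ∕ coordinates the N10 term of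
record uses is NODE 00's ∕ def-T's word (census item 2) — NOT claimed here; a LOCATED INSTANCE.

WHAT THIS FILE PROVES (all `theorem`s; `i : KIdx` def-Y's index; `N ≥ 1`; `G ≤ U(N)`; `hNf : N₀ = Nf`).
* §1 ★ `hDQ_blkCornerY` ∕ `hDQs_blkCornerY` (the R-station's `Q′`-support binders WITH `D_Q′ = (d+1)(L^k − 1)`), `qpK_eq_ite` ∕ `abs_qpK_le_one`, ★ `sum_abs_qpsK_le_one`
  (`Σ_s |Q′*(z,s)| ≤ 1` — `hCQsr` WITH `CQsr = 1`), ★ `sum_abs_qpK_col_le_one` (`Σ_s |Q′(s,z)| ≤ 1` — `hCQc` WITH `CQc = 1`).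
* §2 ★★★★ `exists_rawEntryLetters_toMatrix_GAY_recordV4_prodCfg_of_reg335_located` — dag-n10-w2's §1 with every NODE-00 ∕ reading ∕ coordinate numeral a number.
HONEST FRAMING: located instance; the numbers are finite-lattice constants at the coarsest scale (NOT optimised, NOT print's `O(1)`); the two ANALYTIC inputs — `hXi`
(Theorem 3.2's content; on (3.35) it is dag-n10-w5's tree theorem `B13XinvSymLettersOfReg335.rawEntryLetters_toMatrix_XinvY_parSymY_prodCfg_of_reg335`, which a consumer
may feed here BY NAME with its own numerals) and row 17's QUALITATIVE clause `PosDefTr w (Δ_a(U₀))` (Theorems 3.3 ∕ 3.11, N06's; the lane's LOCATED-ASK for the quantitative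
`hco` stands) — are DISPLAYED, not proved; conclusion qualitative in the rate exactly as dag-n10-w2's; nothing of Bałaban's asserted; N06 ∕ N10 NOT discharged; K1⁸
stmt-QuantumFields-26907 OPEN, no registered stub proved; counts unmoved (typed 28∕28 · discharged 5∕27); 0 `def`, 0 `sorry`, standard axioms; one finite 𝕋⁴ programme at
fixed ε, Bałaban AS PRINTED — R4 closes the conditional finite-𝕋⁴ rung `BalabanLadder.UV` only; the YM mass gap (Clay) is NOT proved by any of this; nothing continuum ∕ ℝ⁴ ∕ OS.

References: T. Bałaban, CMP 99 (1985) 389–434 [Balaban1985BackgroundPropagators] (3.19)–(3.27) pp.393–395, (3.35) p.396, Thm 3.1 (3.42) p.397, Thm 3.2 (3.48) p.398, Thm 3.3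
p.399, Thm 3.4 p.400, (3.60)–(3.72) pp.402–403, (3.84)–(3.86) p.407, Thm 3.10 (3.107)–(3.108) pp.415–416, Thm 3.11 p.416; CMP 96 (1984) 223–250 [Balaban1984PropagatorsII]
(2.14)–(2.17) p.225, (2.45)–(2.46) p.231, (2.68)–(2.69) p.235, Lemma 2.1 (2.61) p.234; CMP 116 (1988) 1–22 [Balaban1988RG2Cluster] (2.5)–(2.7) pp.12–13, p.15.

v1.1 (APPEND-ONLY; §1–§2 byte-identical; + import of dag-n10-w5's `B13XinvSymLettersOfReg335Located` p623629): + §3 ★★★★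
`exists_rawEntryLetters_toMatrix_GAY_recordV4_prodCfg_of_reg335_located_of_xinvLocated` — §2 with the X⁻¹-junction's output `hXi` DISCHARGED BY NAME by dag-n10-w5's located
X⁻¹ knit on (3.35) (`rawEntryLetters_toMatrix_XinvY_parSymY_prodCfg_of_reg335_located`: Theorem 3.2's content at the block reading, radius `R₁ ≤ R₁⋆`), taking `R′ := R₁`,
`ρ_X := ρ″`, `μ := ρ″∕4`: for EVERY `U₀ ∈ Reg335 c α₀` the v4 G-chain's letters at `bondReadingY i i.hN` follow from the (3.35) data, `η`, `0 < Rc`, the rate window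
`0 ≤ ρ′ < δ₀∕((d+1)L^k)`, dag-n10-w5's `(μ, κ)` window with its ONE numeric smallness `hκm`, a rate `0 < ρ″ < κ`, and row 17's ONE clause `hpd : PosDefTr w (Δ_a(U₀))` — NO
dictionary numeral, NO X⁻¹ letter displayed.  HONEST FRAMING unchanged: located instance; Theorem 3.2 enters through dag-n10-w5's tree theorem (n06-w1's scope: one finite
lattice operator, rates per lattice step), Theorems 3.3 ∕ 3.11 stay the displayed qualitative clause; count-neutral.
v1.2 (APPEND-ONLY; §1–§3 byte-identical): + §4 ★★★★ A6 `exists_rawEntryLetters_toMatrix_GAY_recordV4_prodCfg_one_located` — dag-n10-w2 g3's UNIT-BACKGROUND theorem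
`…_recordV4_prodCfg_one` (no analytic hypothesis) at the readings of record with every NODE-00 numeral a number: displayed ONLY `hG`, `0 < c`, `0 < α₀`,
`c·M·α₀·(d+1) ≤ 1∕16`, `hNf`, `η`, `0 < Rc`, `0 < ρ′ < δ₀∕((d+1)L^k)` ⟹ the located G letters at `U₀ = 1` — the binder architecture of §2 ∕ §3 is jointly inhabited.
-/

noncomputable section

namespace Literature.MathematicalPhysics.QuantumFieldTheory.Balaban1983to89.B13GreenSymLettersOfReg335Located

open Finset Module
open scoped Matrix Matrix.Norms.L2Operator
open Literature.MathematicalPhysics.QuantumFieldTheory.Balaban1983to89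
open Literature.MathematicalPhysics.QuantumFieldTheory.Balaban1983to89.B9Thm37GlueTorus (tdist1)
open Literature.MathematicalPhysics.QuantumFieldTheory.Balaban1983to89.B5TorusCover (UT)
open Literature.MathematicalPhysics.QuantumFieldTheory.Balaban1983to89.B4TorusKernel.MultiPeriod (torusSupNorm)
open Literature.MathematicalPhysics.QuantumFieldTheory.Balaban1983to89.B9Thm311ReadingCoords (trIP PosDefTr)
open Literature.MathematicalPhysics.QuantumFieldTheory.Balaban1983to89.B13EntrywiseWalks (RawEntryLetters)
open Literature.MathematicalPhysics.QuantumFieldTheory.Balaban1983to89.B9Eq39Adjoint (prodCfg)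
open Literature.MathematicalPhysics.QuantumFieldTheory.Balaban1983to89.B6GlobalChartV1 (PV boxEquiv)
open Literature.MathematicalPhysics.QuantumFieldTheory.Balaban1983to89.B6KLevelCensusIndexV1 (KIdx kGeo)
open Literature.MathematicalPhysics.QuantumFieldTheory.Balaban1983to89.B9BackgroundsKLevelV1 (bg9K)
open Literature.MathematicalPhysics.QuantumFieldTheory.Balaban1983to89.B6Geom246MultiLevelBox (blkOf)
open Literature.MathematicalPhysics.QuantumFieldTheory.Balaban1983to89.B6Ineq268MultiLevelBox (W W_pos)
open Literature.MathematicalPhysics.QuantumFieldTheory.Balaban1983to89.Node00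
  (SiteY FBondY BlkY CfgY qpK qpsK blkCornerY toKT parSymY parBY GpY XinvY deltaAY GAY)
open Literature.MathematicalPhysics.QuantumFieldTheory.Balaban1983to89.B9Eq3104CutoffCommutatorSizes (qpK_ne_zero_imp qpsK_ne_zero_imp)
open Literature.MathematicalPhysics.QuantumFieldTheory.Balaban1983to89.B9Thm37CubeCoverCommutatorSizes (sum_abs_avgCoeffY_le_one)
open Literature.MathematicalPhysics.QuantumFieldTheory.Balaban1983to89.B13GreenSymLettersOfReg335
  (exists_rawEntryLetters_toMatrix_GAY_recordV4_prodCfg_of_reg335_of_posDefTr)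
open Literature.MathematicalPhysics.QuantumFieldTheory.Balaban1983to89.B13SiteReadingNumerals
  (fineReadingY hD_avgCoeffY hℓ_fineReadingY hℓa_fineReadingY hκ_fineReadingY hfib_fineReadingY_matrixUnits)
open Literature.MathematicalPhysics.QuantumFieldTheory.Balaban1983to89.B13BlockBondReadingNumerals
  (blkReadingY bondReadingY tdist_chart_blkCornerY_le_of_blkOf_eq hℓQ_blkReadingY hℓQs_blkReadingY hℓG_bondReadingY hℓD_bondReadingY card_fibre_bondReadingY_matrixUnits)
open Literature.MathematicalPhysics.QuantumFieldTheory.Balaban1983to89.B13BondAveragingReadingNumerals (hD_qK hD'_qsK hℓq_bondReadingY)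
open Literature.MathematicalPhysics.QuantumFieldTheory.Balaban1983to89.B13CurlIncidenceNumerals (sum_abs_curlK_le card_filter_edgeY_le sum_abs_cocurlK_le)
open Literature.MathematicalPhysics.QuantumFieldTheory.Balaban1983to89.B13DeltaAPencilLettersLocated
  (hcQ_le_one hcQs_le_two hca_of_globalBand ca_globalBand_nonneg hℓp_bondReadingY_rangeQ2)
open Literature.MathematicalPhysics.QuantumFieldTheory.Balaban1983to89.B13GreenStationLocated (sum_abs_gradK_le sum_abs_divK_le)

variable {d ℓ : ℕ} {hd : 1 ≤ d + 1} {hL : Odd (ℓ + 1) ∧ 1 < ℓ + 1} {b₀ b₁ : ℝ}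
variable (i : KIdx d ℓ hd hL b₀ b₁)

/-! ## §1. The `Q′` kernel numerals of the R-station: `D_Q′ = (d+1)(L^k − 1)`, `C_{Q′*} = C_{Q′} = 1` -/

section QPrime

/-- ★ **THE R-STATION's `hDQ` AS A NUMBER**: `Q′(s,z) ≠ 0 ⟹ |chart⁻¹(corner s) − chart⁻¹ z|₁ ≤ (d+1)(L^k − 1)` (`z` lies in the block `Δ(s)`, n06's `qpK_ne_zero_imp`; the corner
leg, `B13BlockBondReadingNumerals.tdist_chart_blkCornerY_le_of_blkOf_eq`). [cite: Balaban1984PropagatorsII, (2.14) p.225, (2.45) p.231; Balaban1985BackgroundPropagators, (3.19) p.393, (3.108) p.416] -/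
theorem hDQ_blkCornerY : ∀ (s : BlkY i) (z : SiteY i), qpK i s z ≠ 0 →
    Site.tdist ((boxEquiv i.hN).symm (blkCornerY i s)) ((boxEquiv i.hN).symm z) ≤ (d + 1) * ((ℓ + 1) ^ i.k - 1) :=
  fun _ _ h => tdist_chart_blkCornerY_le_of_blkOf_eq i (qpK_ne_zero_imp i h)

/-- ★ **… and `hDQs`**: `Q′*(z,s) ≠ 0 ⟹ |chart⁻¹(corner s) − chart⁻¹ z|₁ ≤ (d+1)(L^k − 1)`. [cite: Balaban1984PropagatorsII, (2.15)–(2.17) p.225, (2.45) p.231; Balaban1985BackgroundPropagators, (3.19) p.393, (3.108) p.416] -/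
theorem hDQs_blkCornerY : ∀ (z : SiteY i) (s : BlkY i), qpsK i z s ≠ 0 →
    Site.tdist ((boxEquiv i.hN).symm (blkCornerY i s)) ((boxEquiv i.hN).symm z) ≤ (d + 1) * ((ℓ + 1) ^ i.k - 1) :=
  fun _ _ h => tdist_chart_blkCornerY_le_of_blkOf_eq i (qpsK_ne_zero_imp i h)

/-- NODE 00's `Q′` kernel is the normalised block indicator: `Q′(s,z) = [z ∈ Δ(s)]∕W(s)` (p21's `QM`, by `rfl`). [cite: Balaban1984PropagatorsII, (2.14) p.225, dictionary] -/
theorem qpK_eq_ite (s : BlkY i) (z : SiteY i) : qpK i s z = if blkOf i.D.toDomains z = s then (W i.D.toDomains s)⁻¹ else 0 := rfl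

/-- `|Q′(s,z)| ≤ 1` (`W(s) = len(s)^{d+1} ≥ 1`). [cite: Balaban1984PropagatorsII, (2.14) p.225, (2.69) p.235, bookkeeping] -/
theorem abs_qpK_le_one (s : BlkY i) (z : SiteY i) : |qpK i s z| ≤ 1 := by
  rw [qpK_eq_ite]
  split_ifs
  · have hW : (1 : ℝ) ≤ W i.D.toDomains s := by
      unfold W
      rw [B6Ineq268MultiLevelBox.geom_len, mul_one]
      have hL1 : (1 : ℝ) ≤ (ℓ : ℝ) + 1 := by linarith [(Nat.cast_nonneg ℓ : (0 : ℝ) ≤ ℓ)]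
      exact one_le_pow₀ (one_le_pow₀ hL1)
    rw [abs_of_nonneg (inv_nonneg.2 (zero_le_one.trans hW))]
    exact inv_le_one_of_one_le₀ hW
  · simp

open Classical in
/-- ★ **THE R-STATION's `hCQsr` WITH `CQsr = 1`**: `Σ_s |Q′*(z,s)| ≤ 1` — a site lies in exactly one block of `𝔅`. [cite: Balaban1984PropagatorsII, (2.15) p.225, (2.45) p.231, (2.69) p.235] -/
theorem sum_abs_qpsK_le_one : ∀ z : SiteY i, ∑ s, |qpsK i z s| ≤ 1 := by
  intro z
  -- `Q′*(z,s) = [z ∈ Δ(s)]` is p21's `QsM` by `rfl` (public name `B9B8KnitLetterTransfer.qpsK_apply`, a distant module not imported here)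
  have h : ∀ s : BlkY i, |qpsK i z s| = if blkOf i.D.toDomains z = s then (1 : ℝ) else 0 := fun s => by
    rw [show qpsK i z s = if blkOf i.D.toDomains z = s then 1 else 0 from rfl]; split_ifs <;> simp
  rw [Finset.sum_congr rfl fun s _ => h s, Finset.sum_ite_eq]
  split_ifs <;> norm_num

open Classical in
/-- ★ **THE R-STATION's `hCQc` WITH `CQc = 1`**: `Σ_s |Q′(s,z)| ≤ 1` — the one block containing `z` contributes `1∕W ≤ 1`. [cite: Balaban1984PropagatorsII, (2.14) p.225, (2.45) p.231, (2.68) p.235] -/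
theorem sum_abs_qpK_col_le_one : ∀ z : SiteY i, ∑ s, |qpK i s z| ≤ 1 := by
  intro z
  have h : ∀ s : BlkY i, |qpK i s z| = if blkOf i.D.toDomains z = s then |qpK i s z| else 0 := fun s => by
    by_cases hs : blkOf i.D.toDomains z = s
    · rw [if_pos hs]
    · rw [if_neg hs, qpK_eq_ite, if_neg hs, abs_zero]
  rw [Finset.sum_congr rfl fun s _ => h s, Finset.sum_ite_eq]
  split_ifs
  · exact abs_qpK_le_one i _ z
  · norm_num

end QPrime

/-! ## §2. ★★★★ dag-n10-w2's v4 G-chain on the (3.35) class LOCATED at `(M_N(ℂ), matrix units, fineReadingY ∕ blkReadingY ∕ bondReadingY)` -/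

section Located

variable {N : ℕ} [NeZero N] {G : Subgroup (Matrix (Fin N) (Fin N) ℂ)ˣ}
variable {Nf : Fin (d + 1) → ℕ} [∀ μ, NeZero (Nf μ)]

/-- ★★★★ **THE v4 G-CHAIN ON (3.35), EVERY NODE-00 NUMERAL A NUMBER.**  For EVERY background `U₀ ∈ (bg9K (M_N ℂ) G i).Reg335 c α₀` (`G ≤ U(N)`, `0 ≤ c·M·α₀`,
`c·M·α₀·(d+1) ≤ 1∕16`), at the v4 letters of record, matrix-unit coordinates, sites read by `fineReadingY`, blocks by `blkReadingY`, bonds by `bondReadingY`: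
dag-n10-w2's `exists_rawEntryLetters_toMatrix_GAY_recordV4_prodCfg_of_reg335_of_posDefTr` with `D = 2(d+1)(L^k − 1)`, `Cavg = 1`, `s = (d+1)L^k`, `κ = 1∕((d+1)L^k)`, `m = N²`,
`D_Q = (d+1)(L^k − 1)`, `CQsr = CQc = 1`, `r = (d+1)(L^k − 1)`, `c₁ = 4|c_f|`, `c₂ = 4(d+1)|c_f|`, `N_b = 4(d+1)`, `D_a = (d+2)(L^k − 1)`, `c_Q = 1`, `c_{Q*} = 2`,
`c_a = |b₁|c_f²(L^k)^{d+1}`, `s_F = 2(d+2)(L^k − 1)`, `CgR = CdC = 2|c_f|`, `r′ = 1`, `m_F = (d+1)N²` substituted.  DISPLAYED ONLY: the (3.35) data, `hNf`, `η`, `0 < Rc`, the rate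
`0 ≤ ρ′ < δ₀∕((d+1)L^k)` (`δ₀ = 1∕(4(d+2))`), a radius `0 < R′ ≤ R₁⋆` (79's thin radius, numbers written in), the X⁻¹-junction's output `hXi` at `(blkReadingY, R′, ρ_X)` with
`0 ≤ ρ_X ≤ ρ′`, the R-station's rate loss `0 < μ`, `2μ < ρ_X`, and row 17's ONE clause `hpd : PosDefTr w (Δ_a(U₀))` with its weight `w > 0` and ratio numeral `Θ`.
[cite: Balaban1985BackgroundPropagators, (3.19)–(3.27) pp.393–395, (3.35) p.396, Thm 3.1 (3.42) p.397, Thm 3.2 (3.48) p.398, Thm 3.3 p.399, Thm 3.4 p.400, (3.60)–(3.72) pp.402–403, (3.84)–(3.86) p.407, Thm 3.10 (3.107)–(3.108) pp.415–416, Thm 3.11 p.416; Balaban1984PropagatorsII, (2.14)–(2.17) p.225, Lemma 2.1 (2.61) p.234; Balaban1988RG2Cluster, (2.5)–(2.7) pp.12–13, p.15] -/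
theorem exists_rawEntryLetters_toMatrix_GAY_recordV4_prodCfg_of_reg335_located
    (hG : G ≤ B7Prop2Explicit.unitaryUnits (Matrix (Fin N) (Fin N) ℂ))
    {U₀ : CfgY (Matrix (Fin N) (Fin N) ℂ) i} {c α₀ : ℝ} (hC0 : 0 ≤ c * (kGeo i).M * α₀) (hC1 : c * (kGeo i).M * α₀ * ((d : ℝ) + 1) ≤ 1 / 16)
    (hreg : (bg9K (Matrix (Fin N) (Fin N) ℂ) G i).Reg335 c α₀ U₀)
    (hNf : ∀ μ, (toKT i).NB μ = Nf μ) (η : ℝ) {Rc : ℝ} (hRc : 0 < Rc)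
    {ρ' : ℝ} (hρ'0 : 0 ≤ ρ') (hρ' : ρ' < (1 / (4 * ((d : ℝ) + 2))) * (((d : ℝ) + 1) * ((((ℓ + 1) ^ i.k : ℕ) : ℝ)))⁻¹)
    {R' : ℝ} (hR'0 : 0 < R')
    (hR' : R' ≤ Rc / (4 * ((1 * (((d : ℝ) + 1) *
          (1 * Real.exp (|η| * Rc) * (1 * Real.exp (|η| * Rc) * 1 * (1 * Real.exp (|η| * Rc)) + 1) * (1 * Real.exp (|η| * Rc)) +
            (1 * Real.exp (|η| * Rc) * 1 * (1 * Real.exp (|η| * Rc)) + 1)) +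
          1 * ((1 * Real.exp (|η| * Rc)) ^ (2 * (d + 1) * ((ℓ + 1) ^ i.k - 1)) * 1 * (1 * Real.exp (|η| * Rc)) ^ (2 * (d + 1) * ((ℓ + 1) ^ i.k - 1)))) * Real.exp ((1 / (4 * ((d : ℝ) + 2)) * ((((d : ℝ) + 1) * ((((ℓ + 1) ^ i.k : ℕ) : ℝ)))⁻¹)) * (((d : ℝ) + 1) * ((((ℓ + 1) ^ i.k : ℕ) : ℝ))))) *
          (1 * 1 * (16 * ((((ℓ + 1) ^ i.k : ℕ) : ℝ)) ^ 2 * Real.sqrt N)) *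
          (((N * N : ℕ) : ℝ) * B6.c0 1 (((1 / (4 * ((d : ℝ) + 2))) * ((((d : ℝ) + 1) * ((((ℓ + 1) ^ i.k : ℕ) : ℝ)))⁻¹) - ρ') / 3) ^ (d + 1)) * (((N * N : ℕ) : ℝ) * B6.c0 1 (((1 / (4 * ((d : ℝ) + 2))) * ((((d : ℝ) + 1) * ((((ℓ + 1) ^ i.k : ℕ) : ℝ)))⁻¹) - ρ') / 3) ^ (d + 1))) + 1))
    {ρX BX μ : ℝ} (hρX0 : 0 ≤ ρX) (hρX : ρX ≤ ρ')
    (hXi : RawEntryLetters (fun a : Fin (d + 1) → Site (PV d ℓ i.m i.K hd hL) 0 → Matrix (Fin N) (Fin N) ℂ =>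
      LinearMap.toMatrix
        ((Pi.basis fun _ : BlkY i => Matrix.stdBasis ℂ (Fin N) (Fin N)).reindex (Equiv.sigmaEquivProd (BlkY i) (Fin N × Fin N)))
        ((Pi.basis fun _ : BlkY i => Matrix.stdBasis ℂ (Fin N) (Fin N)).reindex (Equiv.sigmaEquivProd (BlkY i) (Fin N × Fin N)))
        (XinvY i (parSymY i) (GpY i (parSymY i)) (prodCfg U₀ η a)))
      (fun p : BlkY i × (Fin N × Fin N) => blkReadingY i hNf p.1) R' ρX BX)
    (hμ : 0 < μ) (h2μ : 2 * μ < ρX)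
    (w : FBondY i → ℝ) (hw : ∀ s, 0 < w s) {Θ : ℝ} (hΘ0 : 0 ≤ Θ) (hΘ : ∀ s t : FBondY i, Real.sqrt (w s) ≤ Θ * Real.sqrt (w t))
    (hpd : PosDefTr w (deltaAY i (parSymY i) (parBY i) (GpY i (parSymY i)) U₀)) :
    ∃ κ : ℝ, 0 < κ ∧ ∃ BG : ℝ, 0 ≤ BG ∧ ∀ ρ'' : ℝ, 0 ≤ ρ'' → ρ'' < κ → ∃ R₁ : ℝ, 0 < R₁ ∧
      RawEntryLetters (fun a : Fin (d + 1) → Site (PV d ℓ i.m i.K hd hL) 0 → Matrix (Fin N) (Fin N) ℂ =>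
          LinearMap.toMatrix
            ((Pi.basis fun _ : FBondY i => Matrix.stdBasis ℂ (Fin N) (Fin N)).reindex (Equiv.sigmaEquivProd (FBondY i) (Fin N × Fin N)))
            ((Pi.basis fun _ : FBondY i => Matrix.stdBasis ℂ (Fin N) (Fin N)).reindex (Equiv.sigmaEquivProd (FBondY i) (Fin N × Fin N)))
            (GAY i (parSymY i) (parBY i) (GpY i (parSymY i)) (prodCfg U₀ η a)))
        (fun p : FBondY i × (Fin N × Fin N) => bondReadingY i hNf p.1) R₁ ρ'' BG :=
  exists_rawEntryLetters_toMatrix_GAY_recordV4_prodCfg_of_reg335_of_posDefTr i hG hC0 hC1 hreg η hRc (hD_avgCoeffY i) zero_le_one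
    (sum_abs_avgCoeffY_le_one i) (fineReadingY i hNf) (by positivity) (hℓ_fineReadingY i hNf) (hℓa_fineReadingY i hNf) (by positivity) (hκ_fineReadingY i hNf)
    (hfib_fineReadingY_matrixUnits i hNf) hρ'0 hρ' hR'0 hR' (hDQ_blkCornerY i) (hDQs_blkCornerY i) zero_le_one (sum_abs_qpsK_le_one i) zero_le_one
    (sum_abs_qpK_col_le_one i) (blkReadingY i hNf) (hℓQ_blkReadingY i hNf) (hℓQs_blkReadingY i hNf) hρX0 hρX hXi hμ h2μ (by positivity) (by positivity)
    (sum_abs_curlK_le i) (sum_abs_cocurlK_le i) (by positivity) (card_filter_edgeY_le i) (hD_qK i) (hD'_qsK i) zero_le_one zero_le_two (ca_globalBand_nonneg i)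
    (hcQ_le_one i) (hcQs_le_two i) (hca_of_globalBand i) (bondReadingY i hNf) (hℓp_bondReadingY_rangeQ2 i hNf) (hℓq_bondReadingY i hNf) (by positivity)
    (sum_abs_gradK_le i) (by positivity) (sum_abs_divK_le i) (hℓG_bondReadingY i hNf) (hℓD_bondReadingY i hNf) (card_fibre_bondReadingY_matrixUnits i hNf)
    w hw hΘ0 hΘ hpd


/-- ★★★★ **THE v4 G-CHAIN ON (3.35) FED BY dag-n10-w5's LOCATED X⁻¹ KNIT — NO DICTIONARY NUMERAL, NO X⁻¹ LETTER DISPLAYED.**  For EVERY background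
`U₀ ∈ (bg9K (M_N ℂ) G i).Reg335 c α₀` (`G ≤ U(N)`, `0 ≤ c·M·α₀`, `c·M·α₀·(d+1) ≤ 1∕16`): §2 with `hXi :=`
`B13XinvSymLettersOfReg335Located.rawEntryLetters_toMatrix_XinvY_parSymY_prodCfg_of_reg335_located` (its radius `R₁ ≤ R₁⋆` is §2's `R′`; `ρ_X := ρ″`, `μ := ρ″∕4`).
DISPLAYED ONLY: the (3.35) data, `η`, `0 < Rc`, `0 ≤ ρ′ < δ₀∕((d+1)L^k)`, dag-n10-w5's window `0 < μ < ρ′`, `0 ≤ κ ≤ (ρ′−μ)∕4` with its one numeric smallness `hκm`, a rate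
`0 < ρ″ < κ`, and row 17's clause `(w, Θ, hpd)`.  Conclusion qualitative in the rate, as §2.
[cite: Balaban1985BackgroundPropagators, (3.19)–(3.27) pp.393–395, (3.35) p.396, Thm 3.1 (3.42) p.397, Thm 3.2 (3.48) p.398, Thm 3.3 p.399, Thm 3.4 p.400, (3.84)–(3.86) p.407, Thm 3.10 (3.107)–(3.108) pp.415–416, Thm 3.11 p.416; Balaban1984PropagatorsII, Lemma 2.1 (2.61) p.234; Balaban1988RG2Cluster, (2.5)–(2.7) pp.12–13, p.15] -/
theorem exists_rawEntryLetters_toMatrix_GAY_recordV4_prodCfg_of_reg335_located_of_xinvLocated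
    (hG : G ≤ B7Prop2Explicit.unitaryUnits (Matrix (Fin N) (Fin N) ℂ))
    {U₀ : CfgY (Matrix (Fin N) (Fin N) ℂ) i} {c α₀ : ℝ} (hC0 : 0 ≤ c * (kGeo i).M * α₀) (hC1 : c * (kGeo i).M * α₀ * ((d : ℝ) + 1) ≤ 1 / 16)
    (hreg : (bg9K (Matrix (Fin N) (Fin N) ℂ) G i).Reg335 c α₀ U₀)
    (η : ℝ) {Rc : ℝ} (hRc : 0 < Rc)
    {ρ' : ℝ} (hρ'0 : 0 ≤ ρ') (hρ' : ρ' < (1 / (4 * ((d : ℝ) + 2))) * ((((d : ℝ) + 1) * ((((ℓ + 1) ^ i.k : ℕ) : ℝ)))⁻¹))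
    {μ : ℝ} (hμ : 0 < μ) (hμρ : μ < ρ')
    {κ : ℝ} (hκ : 0 ≤ κ) (hκ4 : κ ≤ (ρ' - μ) / 4)
    (hκm : 8 * (Real.sqrt ((((ℓ : ℝ) + 1) ^ i.k) ^ (d + 1)) *
        (1 * (Fintype.card (Fin N × Fin N) : ℝ) *
            (1 * ((1 * Real.exp (|η| * Rc)) ^ ((d + 1) * ((ℓ + 1) ^ i.k - 1)) * 1 * (1 * Real.exp (|η| * Rc)) ^ ((d + 1) * ((ℓ + 1) ^ i.k - 1)))) *
          ((((ℓ : ℝ) + 1) ^ i.k) ^ (d + 1) * (Fintype.card (Fin N × Fin N) : ℝ) *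
            (1 * ((1 * Real.exp (|η| * Rc)) ^ ((d + 1) * ((ℓ + 1) ^ i.k - 1)) * 1 * (1 * Real.exp (|η| * Rc)) ^ ((d + 1) * ((ℓ + 1) ^ i.k - 1))))) *
          ((2 * (1 * 1 * (16 * ((((ℓ + 1) ^ i.k : ℕ) : ℝ)) ^ 2 * Real.sqrt N))) * (2 * (1 * 1 * (16 * ((((ℓ + 1) ^ i.k : ℕ) : ℝ)) ^ 2 * Real.sqrt N))) *
            (((N * N : ℕ) : ℝ) * B6.c0 1 μ ^ (d + 1))) *
          Real.exp (2 * (ρ' - μ) * (((d : ℝ) + 1) * (((((ℓ + 1) ^ i.k : ℕ) : ℝ)) - 1))))) * κ *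
        (((N * N : ℕ) : ℝ) * B6.c0 1 ((ρ' - μ) / 2) ^ (d + 1)) ≤
      ((4 * ((d : ℝ) + 1) + 1) ^ 2)⁻¹ * (ρ' - μ))
    {ρ'' : ℝ} (hρ''0 : 0 < ρ'') (hρ'' : ρ'' < κ)
    (w : FBondY i → ℝ) (hw : ∀ s, 0 < w s) {Θ : ℝ} (hΘ0 : 0 ≤ Θ) (hΘ : ∀ s t : FBondY i, Real.sqrt (w s) ≤ Θ * Real.sqrt (w t))
    (hpd : PosDefTr w (deltaAY i (parSymY i) (parBY i) (GpY i (parSymY i)) U₀)) :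
    ∃ κG : ℝ, 0 < κG ∧ ∃ BG : ℝ, 0 ≤ BG ∧ ∀ ρ''' : ℝ, 0 ≤ ρ''' → ρ''' < κG → ∃ R₁ : ℝ, 0 < R₁ ∧
      RawEntryLetters (fun a : Fin (d + 1) → Site (PV d ℓ i.m i.K hd hL) 0 → Matrix (Fin N) (Fin N) ℂ =>
          LinearMap.toMatrix
            ((Pi.basis fun _ : FBondY i => Matrix.stdBasis ℂ (Fin N) (Fin N)).reindex (Equiv.sigmaEquivProd (FBondY i) (Fin N × Fin N)))
            ((Pi.basis fun _ : FBondY i => Matrix.stdBasis ℂ (Fin N) (Fin N)).reindex (Equiv.sigmaEquivProd (FBondY i) (Fin N × Fin N)))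
            (GAY i (parSymY i) (parBY i) (GpY i (parSymY i)) (prodCfg U₀ η a)))
        (fun p : FBondY i × (Fin N × Fin N) => bondReadingY i i.hN p.1) R₁ ρ''' BG := by
  -- the X⁻¹-junction's output at the block reading, radius `R₁ ≤ R₁⋆`, rate `ρ″` (dag-n10-w5's located knit; Theorem 3.2's content on (3.35))
  obtain ⟨R₁, hR₁0, hR₁le, hXi⟩ := B13XinvSymLettersOfReg335Located.rawEntryLetters_toMatrix_XinvY_parSymY_prodCfg_of_reg335_located i hG hC0 hC1 hreg η hRc
    hρ'0 hρ' hμ hμρ hκ hκ4 hκm hρ''0.le hρ''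
  have hρXle : ρ'' ≤ ρ' := by linarith
  have hμ' : 0 < ρ'' / 4 := by positivity
  have h2μ' : 2 * (ρ'' / 4) < ρ'' := by linarith
  exact exists_rawEntryLetters_toMatrix_GAY_recordV4_prodCfg_of_reg335_located i hG hC0 hC1 hreg i.hN η hRc hρ'0 hρ' hR₁0 hR₁le hρ''0.le hρXle hXi hμ'
    h2μ' w hw hΘ0 hΘ hpd


/-! ## §4. ★★★★ A6 — the located chain AT THE UNIT BACKGROUND: no analytic, no dictionary hypothesis -/

/-- ★★★★ **A6 — THE LOCATED v4 G-CHAIN AT `U₀ = 1` HOLDS WITH NO ANALYTIC AND NO DICTIONARY HYPOTHESIS.**  dag-n10-w2 g3's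
`exists_rawEntryLetters_toMatrix_GAY_recordV4_prodCfg_one` (at the unit background every analytic input of the chain is a TREE theorem: `reg335_one`, dag-n10-w5's X⁻¹ knit,
dag-n06-j's `posDefTr_deltaAY_parSymY_one`; the X⁻¹ smallness window chosen inside by `exists_uniform_rate`) applied POSITIONALLY at the readings of record with every
NODE-00 numeral a number (79's at `fineReadingY`; the X-station's `C_Q = 1` — n06's `B9Thm39CinvSandwichQ.sum_abs_qpK_le_one` — and `C_{Q*} = (L^k)^{d+1}` — dag-n10-w5's
`sum_abs_qpsK_row_le`; §1's R-station rows; 76's; the G-station's).  DISPLAYED ONLY: `hG : G ≤ U(N)`, the (3.35) class parameters `0 < c`, `0 < α₀`, `c·M·α₀·(d+1) ≤ 1∕16`,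
`hNf`, `η`, `0 < Rc`, and the target rate `0 < ρ′ < δ₀∕((d+1)L^k)` — so the binder architecture of §2 ∕ §3 is JOINTLY INHABITED at the readings of record.
[cite: Balaban1985BackgroundPropagators, (3.26)–(3.27) p.395, (3.35) p.396, Thms 3.1–3.3 pp.397–399, Thm 3.4 p.400, (3.84)–(3.86) p.407, Thm 3.10 (3.107)–(3.108) pp.415–416, Thm 3.11 p.416; Balaban1984PropagatorsII, p.226, Prop 2.3 p.238; Balaban1988RG2Cluster, (2.5)–(2.7) pp.12–13, p.15] -/
theorem exists_rawEntryLetters_toMatrix_GAY_recordV4_prodCfg_one_located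
    (hG : G ≤ B7Prop2Explicit.unitaryUnits (Matrix (Fin N) (Fin N) ℂ))
    {c α₀ : ℝ} (hc : 0 < c) (hα : 0 < α₀) (hC1 : c * (kGeo i).M * α₀ * ((d : ℝ) + 1) ≤ 1 / 16)
    (hNf : ∀ μ, (toKT i).NB μ = Nf μ) (η : ℝ) {Rc : ℝ} (hRc : 0 < Rc)
    {ρ' : ℝ} (hρ'0 : 0 < ρ') (hρ' : ρ' < (1 / (4 * ((d : ℝ) + 2))) * ((((d : ℝ) + 1) * ((((ℓ + 1) ^ i.k : ℕ) : ℝ)))⁻¹)) :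
    ∃ κ : ℝ, 0 < κ ∧ ∃ BG : ℝ, 0 ≤ BG ∧ ∀ ρ'' : ℝ, 0 ≤ ρ'' → ρ'' < κ → ∃ R₁ : ℝ, 0 < R₁ ∧
      RawEntryLetters (fun a : Fin (d + 1) → Site (PV d ℓ i.m i.K hd hL) 0 → Matrix (Fin N) (Fin N) ℂ =>
          LinearMap.toMatrix
            ((Pi.basis fun _ : FBondY i => Matrix.stdBasis ℂ (Fin N) (Fin N)).reindex (Equiv.sigmaEquivProd (FBondY i) (Fin N × Fin N)))
            ((Pi.basis fun _ : FBondY i => Matrix.stdBasis ℂ (Fin N) (Fin N)).reindex (Equiv.sigmaEquivProd (FBondY i) (Fin N × Fin N)))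
            (GAY i (parSymY i) (parBY i) (GpY i (parSymY i))
              (prodCfg ((bg9K (Matrix (Fin N) (Fin N) ℂ) G i).one) η a)))
        (fun p : FBondY i × (Fin N × Fin N) => bondReadingY i hNf p.1) R₁ ρ'' BG :=
  B13GreenSymLettersOfReg335.exists_rawEntryLetters_toMatrix_GAY_recordV4_prodCfg_one i hG hc hα hC1 η hRc (hD_avgCoeffY i) zero_le_one (sum_abs_avgCoeffY_le_one i) (fineReadingY i hNf)
    (by positivity) (hℓ_fineReadingY i hNf) (hℓa_fineReadingY i hNf) (by positivity) (hκ_fineReadingY i hNf) (hfib_fineReadingY_matrixUnits i hNf) hρ'0 hρ'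
    (hDQ_blkCornerY i) (hDQs_blkCornerY i) zero_le_one (B9Thm39CinvSandwichQ.sum_abs_qpK_le_one i) (by positivity)
    (B13XinvSymLettersOfReg335Located.sum_abs_qpsK_row_le i) zero_le_one (sum_abs_qpsK_le_one i) zero_le_one (sum_abs_qpK_col_le_one i) (blkReadingY i hNf)
    (hℓQ_blkReadingY i hNf) (hℓQs_blkReadingY i hNf) (B13BlockBondReadingNumerals.card_fibre_blkReadingY_matrixUnits i hNf) (by positivity) (by positivity) (sum_abs_curlK_le i)
    (sum_abs_cocurlK_le i) (by positivity) (card_filter_edgeY_le i) (hD_qK i) (hD'_qsK i) zero_le_one zero_le_two (ca_globalBand_nonneg i) (hcQ_le_one i)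
    (hcQs_le_two i) (hca_of_globalBand i) (bondReadingY i hNf) (hℓp_bondReadingY_rangeQ2 i hNf) (hℓq_bondReadingY i hNf) (by positivity) (sum_abs_gradK_le i)
    (by positivity) (sum_abs_divK_le i) (hℓG_bondReadingY i hNf) (hℓD_bondReadingY i hNf) (card_fibre_bondReadingY_matrixUnits i hNf)

end Located

end Literature.MathematicalPhysics.QuantumFieldTheory.Balaban1983to89.B13GreenSymLettersOfReg335Located

end
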